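/-
Copyright (c) 2026 the pub-hodgecm-mathlib formalisation cell (harness21).  Prover seat hodgecm-mathlib-F0P3a-p01 (g37), FLOOR 0, SUPPORTS-ONLY on h413; β-BOARD v1 R10
(assembler ∕ chair): the TOWER-3 κ line `hR6₃` as the image of the tower-1 κ line under LH7-p07 (g0)'s ★ p862014 engine `(0 2) ∘ α⁻¹` and his token rescale lemmas.  2026-09-04.
-/
import Summits.HodgeConjecture.HodgeConjecture.Theorems.F0P3cDyRamLabelledOddTowerThreeOfTowerOne    -- ★ p862014 (LH7-p07 (g0)): `finsum_stratum_G3_shell_labelledOdd_div_relIndex_eq_of_G1`, `exists_gl_rescale_swap02`, `isElementDatum_rescale`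
import Summits.HodgeConjecture.HodgeConjecture.Theorems.F0P3cDyRamTowerSignTokenRescale             -- (LH7-p07 (g0), ★-pending): `token_inv_sub_one_of_token_sub_one`, `token_mul_inv_sub_inv_of_token_sub_one`
import Summits.HodgeConjecture.HodgeConjecture.Theorems.F0P3cDyRamDiagonalKappaSplitCountEval       -- ★: `normSign_mul_self`
import Literature.NumberTheory.LocalFields.WildQuadraticDatumNormSignConductor                      -- ★: `normSign_mul_of_fixed`
import HarnessLib

/-!
# Crux `H413`, LH4 «(D-RAM) FOUR-FRAME» road, STAGE 1b (β) — THE TOWER-3 κ LINE `hR6₃` FROM THE TOWER-1 κ LINE BY `(0 2) ∘ α⁻¹`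

Cell `hodgecm-mathlib` (D-0151), FLOOR 0, crux item H413 = `stmt-HodgeConjecture-24833`, route `HCCMUnconditional`; squad F0∕P3c∕LH4.  THEOREMS ONLY (no `def`, no instance, no
notation, no `sorry`, default heartbeats); ★-only imports; lane `--supports stmt-HodgeConjecture-24833 --as helper` (count-neutral; pays NO row).

WHAT THIS FILE DOES (chair's LEDGER #16–#17; LH7-p07 (g0) 16:25:37Z ∕ 16:43:14Z).  ★ p862014 shows that every tower-3 row of the (β) table at `(α, β; n₁, n₂, n₃)` is the
tower-1 row at the RESCALED datum `(α⁻¹, β·α⁻¹; n₃, n₂, n₁)` read in slot `(0 2) i` (`…_eq_of_G1`: the coordinate swap (0 2) followed by the unit homothety `α⁻¹`, with the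
clean-shell token perturbation inside).  For the κ line the tower-sign tokens travel too (LH7-p07's `…TowerSignTokenRescale`): the token of `α″ − 1 = α⁻¹ − 1` at depth `n₂` is `−e_A`
(`token_inv_sub_one_of_token_sub_one`), the token of `β″ − α″ = (β − 1)·α⁻¹` at depth `n₁` is `e_B` (`token_mul_inv_sub_inv_of_token_sub_one`).  So LH4-p07 (g10)'s tower-1
κ line — `(ω(eA′) + ω(−1)ω(eC′), 0, 0)_i ∕ 4 · q^(2ρ−1+s∕2) · F(n₁′)` on `2ρ+ℓ₀ = n₂′`, `n₁′ ≠ n₂′ + s` — at `(eA′, eC′) = (−e_A, e_B)` and slot `(0 2) i` is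
`(0, 0, ω(−1)ω_B + ω(−1)ω_A)_i ∕ 4 · q^(2ρ−1+s∕2) · F(n₃)` (`ω(−e_A) = ω(−1)ω_A` ★ `normSign_mul_of_fixed`): the `hR6₃` binder of ★ p861938 `restSum_eq_restTarget_of_rows`
VERBATIM.  The tower-1 κ line enters as a ∀-hypothesis over the element datum at the derived threshold (same shape as in ★ p862074 `kappaLine_G2_of_G1`).
HONEST LABEL.  Count-neutral transport; `hR6₁` is a hypothesis; `hRest`, (β) OPEN; `HC_CM` is proved only modulo the 7 printed citations (2 remaining named inputs: hLiu418 =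
`stmt-HodgeConjecture-24832`, h413 = `stmt-HodgeConjecture-24833`) until rung 0 closes.

## References
* [Kottwitz1986BaseChangeUnits] R. E. Kottwitz, *Base change for unit elements of Hecke algebras*, Compositio Math. 60 (1986), §1 pp. 240–241 (lattice counts modulo the
  diagonal torus; symmetry in the coordinates of the split torus).
* [Rogawski1990] J. D. Rogawski, *Automorphic Representations of Unitary Groups in Three Variables*, Ann. of Math. Stud. 123 (1990), §4.9 Prop. 4.9.1 (a)(b) p. 55, §4.10 p. 58.
* [Serre1979] J.-P. Serre, *Local Fields*, GTM 67, Springer (1979), Ch. V §3 (the norm residue character of a ramified quadratic extension).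
-/

set_option autoImplicit false

noncomputable section

namespace Summit.HodgeConjecture.HodgeConjecture.Cruxes.H413.F0P3cDyRamOddLabelledRestRowsG3OfSwap

open Matrix
open Literature.NumberTheory.Automorphic Literature.NumberTheory.Automorphic.HermitianLattice
open Literature.NumberTheory.Automorphic.UnitaryLatticeTree Literature.NumberTheory.Automorphic.UnitaryThreeFourFrame
open Literature.NumberTheory.LocalFields Literature.NumberTheory.LocalFields.WildQuadraticDatum
open Summit.HodgeConjecture.HodgeConjecture.Cruxes.H413.F0P3cDyRamFourFramePieces (mstarOfRecord)
open Summit.HodgeConjecture.HodgeConjecture.Cruxes.H413.F0P3cDyRamFourFrameCensusDefs (LatticeInLevel)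
open Summit.HodgeConjecture.HodgeConjecture.Cruxes.H413.F0P3cDyRamStageOneBDefs (mcOfRecord mstarOfRecord_le_mcOfRecord)
open Summit.HodgeConjecture.HodgeConjecture.Cruxes.H413.F0P3cDyRamStageOneBDerivedDefs (n0DerivedOfRecord mcOfRecord_le_n0DerivedOfRecord)
open Summit.HodgeConjecture.HodgeConjecture.Cruxes.H413.F0P3cDyRamDiagonalTorusDefs
open Summit.HodgeConjecture.HodgeConjecture.Cruxes.H413.F0P3cDyRamDiagonalStrataDefs
open Summit.HodgeConjecture.HodgeConjecture.Cruxes.H413.F0P3cDyRamDiagonalPermutation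
open Summit.HodgeConjecture.HodgeConjecture.Cruxes.H413.F0P3cDyRamDiagonalKappaPermutation (exists_gl_rescale_swap02)
open Summit.HodgeConjecture.HodgeConjecture.Cruxes.H413.F0P3cDyRamLabelledOddCountDefs
open Summit.HodgeConjecture.HodgeConjecture.Cruxes.H413.F0P3cDyRamLabelledOddTowerThreeOfTowerOne (finsum_stratum_G3_shell_labelledOdd_div_relIndex_eq_of_G1)
open Summit.HodgeConjecture.HodgeConjecture.Cruxes.H413.F0P3cDyRamTowerSignTokenRescale (token_inv_sub_one_of_token_sub_one token_mul_inv_sub_inv_of_token_sub_one)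
open Summit.HodgeConjecture.HodgeConjecture.Cruxes.H413.F0P3cDyRamDiagonalKappaSplitCountEval (normSign_mul_self)
open scoped Valued WithZero Matrix MatrixGroups

variable {K : Type} [Field K] [Valued K ℤᵐ⁰] {σ : K →+* K} {ϖ : K} {d t : ℕ} {α β : K} {n₁ n₂ n₃ : ℕ}

/-- **THE TOWER-3 κ LINE FROM THE TOWER-1 κ LINE.**  If at EVERY element datum at the derived threshold, with tokens `eA'` (of `α' − 1` at depth `n₂'`) and `eC'` (of `β' − α'`
at depth `n₃'`), the κ-locus classes of tower 1 (`2ρ + ℓ₀ = n₂'`, `n₁' ≠ n₂' + s`) carry LH4-p10's closed form `(ω(eA') + ω(−1)ω(eC'), 0, 0)_i ∕ 4 · q^(2ρ−1+s∕2) · F(n₁')`, then at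
`(α, β; n₁, n₂, n₃)` with tokens `eA` (of `α − 1` at `n₂`) and `eB` (of `β − 1` at `n₁`) the κ-locus classes of tower 3 (`2ρ + ℓ₀ = n₂`, `n₃ ≠ n₂ + s`) carry
`(0, 0, ω(−1)ω_B + ω(−1)ω_A)_i ∕ 4 · q^(2ρ−1+s∕2) · F(n₃)` — the `hR6₃` binder of ★ p861938 VERBATIM (★ p862014 `…_eq_of_G1` at the rescaled datum with tokens `(−eA, eB)`).
[cite: Kottwitz1986BaseChangeUnits, §1 pp. 240–241] [cite: Rogawski1990, §4.9 Prop. 4.9.1 (a)(b) p. 55, §4.10 p. 58] [cite: Serre1979, Ch. V §3] -/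
theorem kappaLine_G3_of_G1 [CompleteSpace K] [Fintype 𝓀[K]] (hD : IsRamifiedQuadraticDatum σ ϖ d t)
    (hR6₁ : ∀ {α' β' : K} {n₁' n₂' n₃' : ℕ} (T' : GL (Fin 3) K) (eA' eC' : K), IsElementDatum σ ϖ (n0DerivedOfRecord d) α' β' n₁' n₂' n₃' →
      (T' : Matrix (Fin 3) (Fin 3) K) = Matrix.diagonal ![α', β', 1] →
      σ eA' = eA' → Valued.v eA' = 1 → Valued.v ((ϖ ^ mstarOfRecord d)⁻¹ * ((α' - 1) * ((ϖ * σ ϖ) ^ ((n₂' - d % 2) / 2))⁻¹ - eA' * ((ϖ - σ ϖ) * ((ϖ * σ ϖ) ^ ((d - d % 2) / 2))⁻¹))) ≤ 1 →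
      σ eC' = eC' → Valued.v eC' = 1 → Valued.v ((ϖ ^ mstarOfRecord d)⁻¹ * ((β' - α') * ((ϖ * σ ϖ) ^ ((n₃' - d % 2) / 2))⁻¹ - eC' * ((ϖ - σ ϖ) * ((ϖ * σ ϖ) ^ ((d - d % 2) / 2))⁻¹))) ≤ 1 →
      ∀ (ρ s : ℕ), 1 ≤ ρ → 1 ≤ s → 2 ∣ s → 2 * ρ + d % 2 = n₂' → n₁' ≠ n₂' + s → ∀ i : Fin 3,
        ∑ᶠ M ∈ {M : Submodule 𝒪[K] (Fin 3 → K) | M ∈ stratum σ ϖ T' ![2 * ρ, 2 * ρ + s, 2 * ρ + s] ∧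
            (LatticeInLevel ϖ (d % 2) (Matrix.diagonal ![α' - 1, β' - 1, 0]) M ∧ ¬ LatticeInLevel ϖ (d % 2 + 1) (Matrix.diagonal ![α' - 1, β' - 1, 0]) M ∧
              LatticeInLevel ϖ (mcOfRecord d) (Matrix.diagonal ![(α' - 1) * (α' - 1), (β' - 1) * (β' - 1), 0]) M)},
          (labelledOddCount σ ϖ 0 i (valueClassLabel σ ϖ (α' - 1) (β' - 1) (mstarOfRecord d) d) M : ℚ) /
            ((((unitStabilizer M).map (unitNormMap σ 3)).relIndex (fixedUnitTorus σ 3) : ℕ) : ℚ) =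
        (![(normSign σ eA' : ℚ) + (normSign σ (-1 : K) : ℚ) * (normSign σ eC' : ℚ), 0, 0] : Fin 3 → ℚ) i / 4 * (Fintype.card 𝓀[K] : ℚ) ^ (2 * ρ - 1 + s / 2) *
          ((if 2 * d + d % 2 + 2 * ρ + s ≤ n₁' then (Fintype.card 𝓀[K] : ℚ) - 1 else 0) - (if n₁' + 2 = 2 * d + d % 2 + 2 * ρ + s then 1 else 0)))
    (hE : IsElementDatum σ ϖ (n0DerivedOfRecord d) α β n₁ n₂ n₃)
    (T : GL (Fin 3) K) (hT : (T : Matrix (Fin 3) (Fin 3) K) = Matrix.diagonal ![α, β, 1])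
    {eA eB : K} (hσeA : σ eA = eA) (heA1 : Valued.v eA = 1) (heA : Valued.v ((ϖ ^ mstarOfRecord d)⁻¹ * ((α - 1) * ((ϖ * σ ϖ) ^ ((n₂ - d % 2) / 2))⁻¹ - eA * ((ϖ - σ ϖ) * ((ϖ * σ ϖ) ^ ((d - d % 2) / 2))⁻¹))) ≤ 1)
    (hσeB : σ eB = eB) (heB1 : Valued.v eB = 1) (heB : Valued.v ((ϖ ^ mstarOfRecord d)⁻¹ * ((β - 1) * ((ϖ * σ ϖ) ^ ((n₁ - d % 2) / 2))⁻¹ - eB * ((ϖ - σ ϖ) * ((ϖ * σ ϖ) ^ ((d - d % 2) / 2))⁻¹))) ≤ 1)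
    (ρ s : ℕ) (hρ : 1 ≤ ρ) (hs : 1 ≤ s) (h2s : 2 ∣ s) (hloc : 2 * ρ + d % 2 = n₂) (hfoot : n₃ ≠ n₂ + s) (i : Fin 3) :
    ∑ᶠ M ∈ {M : Submodule 𝒪[K] (Fin 3 → K) | M ∈ stratum σ ϖ T ![2 * ρ + s, 2 * ρ + s, 2 * ρ] ∧
        (LatticeInLevel ϖ (d % 2) (Matrix.diagonal ![α - 1, β - 1, 0]) M ∧ ¬ LatticeInLevel ϖ (d % 2 + 1) (Matrix.diagonal ![α - 1, β - 1, 0]) M ∧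
          LatticeInLevel ϖ (mcOfRecord d) (Matrix.diagonal ![(α - 1) * (α - 1), (β - 1) * (β - 1), 0]) M)},
      (labelledOddCount σ ϖ 0 i (valueClassLabel σ ϖ (α - 1) (β - 1) (mstarOfRecord d) d) M : ℚ) /
        ((((unitStabilizer M).map (unitNormMap σ 3)).relIndex (fixedUnitTorus σ 3) : ℕ) : ℚ) =
      (![(0 : ℚ), 0, (normSign σ (-1 : K) : ℚ) * (normSign σ eB : ℚ) + (normSign σ (-1 : K) : ℚ) * (normSign σ eA : ℚ)] : Fin 3 → ℚ) i / 4 *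
        (Fintype.card 𝓀[K] : ℚ) ^ (2 * ρ - 1 + s / 2) * ((if 2 * d + d % 2 + 2 * ρ + s ≤ n₃ then (Fintype.card 𝓀[K] : ℚ) - 1 else 0) - (if n₃ + 2 = 2 * d + d % 2 + 2 * ρ + s then 1 else 0)) := by
  have hvσ : ∀ a, Valued.v (σ a) = Valued.v a := hD.2.1
  -- the rescaled torus element `T″ = diag(α⁻¹, βα⁻¹, 1)` and ★ p862014's transport to tower 1 at the rescaled datum
  obtain ⟨P, hP⟩ := exists_gl_coe_eq_permMatrix (K := K) (Equiv.swap (0 : Fin 3) 2)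
  obtain ⟨T'', hT'', -⟩ := exists_gl_rescale_swap02 hE hT P hP
  rw [finsum_stratum_G3_shell_labelledOdd_div_relIndex_eq_of_G1 hD hE hT T'' hT'' ρ s i]
  -- the tokens of the rescaled datum: `−eA` for `α⁻¹ − 1` at `n₂`, `eB` for `βα⁻¹ − α⁻¹` at `n₁`
  have hm : mstarOfRecord d ≤ n0DerivedOfRecord d := (mstarOfRecord_le_mcOfRecord d).trans (mcOfRecord_le_n0DerivedOfRecord d)
  have hσnA : σ (-eA) = -eA := by rw [map_neg, hσeA]
  have hnA1 : Valued.v (-eA) = 1 := by rw [Valuation.map_neg, heA1]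
  have hnA := token_inv_sub_one_of_token_sub_one hD hE hm heA1.le _ heA
  have hnB := token_mul_inv_sub_inv_of_token_sub_one hD hE hm heB1.le _ heB
  rw [hR6₁ T'' (-eA) eB (isElementDatum_rescale hvσ hE) hT'' hσnA hnA1 hnA hσeB heB1 hnB ρ s hρ hs h2s hloc hfoot (Equiv.swap (0 : Fin 3) 2 i)]
  -- `ω(−eA) = ω(−1)·ω(eA)`, then the slot swap `(x, 0, 0)` at `(0 2) i` is `(0, 0, x)` at `i`
  have hσ1 : σ (-1 : K) = -1 := by rw [map_neg, map_one]
  have heA0 : eA ≠ 0 := fun h => by rw [h, map_zero] at heA1; exact zero_ne_one heA1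
  have hneg : normSign σ (-eA) = normSign σ (-1 : K) * normSign σ eA := by
    rw [← neg_one_mul eA, normSign_mul_of_fixed hD hσ1 hσeA (neg_ne_zero.2 one_ne_zero) heA0]
  have hcoef : (normSign σ (-eA) : ℚ) + (normSign σ (-1 : K) : ℚ) * (normSign σ eB : ℚ) =
      (normSign σ (-1 : K) : ℚ) * (normSign σ eB : ℚ) + (normSign σ (-1 : K) : ℚ) * (normSign σ eA : ℚ) := by
    rw [hneg, Int.cast_mul, add_comm]
  simp only [hcoef]
  fin_cases i <;> rfl

end Summit.HodgeConjecture.HodgeConjecture.Cruxes.H413.F0P3cDyRamOddLabelledRestRowsG3OfSwap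

end
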